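import Literature.AlgebraicGeometry.AbelianSchemes.HomKernelTorsionCount
import Literature.AlgebraicGeometry.AbelianSchemes.FibrePointsMulEquivPoints
import Literature.AlgebraicGeometry.AbelianSchemes.PolarizationKernelSubsetKTheta
import Literature.AlgebraicGeometry.AbelianSchemes.AbelianSchemePolarizationTypeUnique
import Literature.GroupTheory.FiniteAbelian.OrderStatisticsCriterion
import HarnessLib

/-!
# The type `δ` of a polarisation is locally constant: on a connected ℚ-base it is read off ONE geometric point

Layer `Literature/AlgebraicGeometry/AbelianSchemes`, namespace `Literature.AlgebraicGeometry.AbelianSchemes.AbelianSchemeOver.Polarization`.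
Cell `hodgecm-mathlib` (D-0151), F-DAG price sheet §5b second-wave hand (h9) «local constancy of the type», FILE 2γ =
the HEAD (author B-p02 (g12)); count-neutral capital, PROOF lane, theorems only.  Consumer: F-6 (V′) — the type-`δ`
locus `H_{g,δ,N}` is OPEN AND CLOSED in MFK's `H_{g,d,N}` (apply the head on each connected component of the locally
Noetherian base).  HC_CM is proved only modulo the 7 printed citations until rung 0 closes; this file asserts nothing about HC.

## Sources, verbatim

* [MumfordFogartyKirwan1994] App. 7A (pp. 234–235): for a polarisation `λ` of degree `d²` «`ker(λ) ≅ ∏ ℤ/δᵢℤ × ∏ μ_{δᵢ}`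
  … `𝒜_{g,d,n}` is the disjoint union of the open and closed subschemes `𝒜_{g,δ,n}`» indexed by the types `δ` with
  `∏ δᵢ = d`.  The tree's `Polarization.HasType δ` (★ `AbelianSchemePolarization`) is the `Ω`-point form: `δ` is a
  polarisation type and at EVERY geometric point `s̄` the kernel `K(λ̄_s̄)` of `λ̄` on `Ω`-points is the image of an
  injective homomorphism from `(∏ᵢ ℤ/δᵢ)²`.
* [Rotman1984] Exercise 6.17 / [Hungerford1974] II Thm. 2.6: two finite abelian groups with the same number of elements
  killed by `n`, for every `n`, are isomorphic — ★ `GroupTheory.FiniteAbelian.nonempty_addEquiv_of_forall_natCard_nsmul_eq_zero_eq`.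

## The proof («transport along specialisations», isogeny-free and Galois-free)

At a geometric point `s̄` of the connected base, `K(λ̄_s̄)` is a finite abelian group (★ `Polarization.finite_kerPointsAt`);
for every `m ≥ 1` its `m`-torsion count is the number of geometric points over `s̄` of the FINITE ÉTALE `S`-scheme
`K_m(λ) ⊆ A[m]` (★ `HomKernelTorsionCount`: `#{u ∈ A_s̄(Ω) | u ≫ λ = 1, u^m = 1}` is the same at all geometric points of a
preconnected base, read through the group isomorphism `Hom_S(Spec Ω, A) ≅ (A ×_S Spec Ω)(Ω)` of ★
`FibrePointsMulEquivPoints`), hence equals the count at the given point `s̄₀`, i.e. that of `(∏ᵢ ℤ/δᵢ)²`; Rotman's criterion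
then gives `K(λ̄_s̄) ≅ (∏ᵢ ℤ/δᵢ)²`.

## What is proved (no `def`, no named fact, no instance, no notation, no `sorry`)

* `natCard_kerPointsAt_torsion_eq_of_preconnectedSpace` — on a preconnected base with `m` invertible, the count
  `#{P ∈ K(λ̄_s̄) | P^m = 1}` is the same at any two geometric points;
* **`hasType_of_exists_mulHom_at`** — THE HEAD: on a preconnected base all of whose residue characteristics kill no
  positive integer (`ℚ`-schemes), if `δ` is a polarisation type and at ONE geometric point `s̄₀` the kernel `K(λ̄_s̄₀)` is
  the image of an injective homomorphism from `(∏ᵢ ℤ/δᵢ)²`, then `pol.HasType δ`;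
* `hasType_of_exists_mulHom_at_of_charZero` — the same for `S` over a field of characteristic zero;
* `hasType_iff_of_preconnectedSpace` — `HasType δ ↔ IsPolarizationType δ ∧ (the clause at s̄₀)`;
* `hasType_unique_of_exists_mulHom_at` — with ★ `HasType.eq_of_hasType`: a type read at one point IS the type.

## References
* [MumfordFogartyKirwan1994] D. Mumford, J. Fogarty, F. Kirwan, *Geometric Invariant Theory*, 3rd ed. (1994), App. 7A
  (pp. 234–235).
* [Rotman1984] J. J. Rotman, *An Introduction to the Theory of Groups*, 3rd ed. (1984), Exercise 6.17.
* [LangeBirkenhake1992] H. Lange, Ch. Birkenhake, *Complex Abelian Varieties* (1992), §3.1 (type of a polarisation).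
-/

noncomputable section

universe u

open CategoryTheory CategoryTheory.Limits AlgebraicGeometry

open scoped MonObj

namespace Literature.AlgebraicGeometry.AbelianSchemes

namespace AbelianSchemeOver

namespace Polarization

open Literature.AlgebraicGeometry.Motives Literature.AlgebraicGeometry.ModuliOfAbelianVarieties

variable {S : Scheme.{u}} {A : AbelianSchemeOver S} {D : A.DualPair} (pol : A.Polarization D)

/-- Over a field of characteristic zero every positive integer is invertible in every residue field of `S`.
[cite: MumfordFogartyKirwan1994, App. 7A (pp. 234–235)] -/
private theorem natCast_residueField_ne_zero {K : Type u} [Field K] [CharZero K] (f : S ⟶ Spec (.of K)) (s : S) {m : ℕ}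
    (hm : 0 < m) : (m : S.residueField s) ≠ 0 := by
  let φ : K →+* S.residueField s := (Spec.preimage (S.fromSpecResidueField s ≫ f)).hom
  rw [← map_natCast φ m]
  exact (map_ne_zero φ).mpr (Nat.cast_ne_zero.mpr hm.ne')

/-! ### §1 The `m`-torsion counts of `K(λ̄)` are locally constant -/

/-- **`#{P ∈ K(λ̄_s̄) | P^m = 1}` is the same at any two geometric points of a preconnected base** (`Ω`, `Ω'` algebraically
closed, `m` invertible in the residue fields of `S`): ★ `natCard_ker_torsion_fibrePoints_eq_of_preconnectedSpace` (the
finite étale `K_m(λ) ⊆ A[m]`) read through ★ `natCard_ker_torsion_fibrePoints_eq_natCard_kerPointsAt_torsion`.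
[cite: MumfordFogartyKirwan1994, App. 7A (pp. 234–235)] -/
theorem natCard_kerPointsAt_torsion_eq_of_preconnectedSpace [PreconnectedSpace S] {m : ℕ}
    (hm : ∀ s : S, (m : S.residueField s) ≠ 0) {Ω Ω' : Type u} [Field Ω] [IsAlgClosed Ω] [Field Ω'] [IsAlgClosed Ω']
    (s : Spec (.of Ω) ⟶ S) (t : Spec (.of Ω') ⟶ S) :
    Nat.card {P : (A.fibre s).toAbelianVariety.Points Ω // P ∈ pol.kerPointsAt s ∧ P ^ m = 1} =
      Nat.card {Q : (A.fibre t).toAbelianVariety.Points Ω' // Q ∈ pol.kerPointsAt t ∧ Q ^ m = 1} := by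
  haveI := pol.isMonHom
  rw [← pol.natCard_ker_torsion_fibrePoints_eq_natCard_kerPointsAt_torsion s m,
    ← pol.natCard_ker_torsion_fibrePoints_eq_natCard_kerPointsAt_torsion t m]
  exact A.natCard_ker_torsion_fibrePoints_eq_of_preconnectedSpace pol.lam hm s t

/-! ### §2 Counting the `m`-torsion inside a subgroup and inside the model group -/

/-- For a subgroup `K` of a group `G` with carrier a set `C`: `#{x ∈ K | x^m = 1} = #{P ∈ G | P ∈ C, P^m = 1}`.
[cite: Rotman1984, Exercise 6.17] -/
private theorem natCard_subgroup_torsion_eq {G : Type*} [Group G] (K : Subgroup G) (C : Set G) (hK : (K : Set G) = C)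
    (m : ℕ) : Nat.card {x : K // x ^ m = 1} = Nat.card {P : G // P ∈ C ∧ P ^ m = 1} := by
  subst hK
  refine Nat.card_congr
    { toFun := fun x => ⟨x.1.1, x.1.2, by rw [← Subgroup.coe_pow, x.2, Subgroup.coe_one]⟩
      invFun := fun P => ⟨⟨P.1, P.2.1⟩, Subtype.ext (by rw [Subgroup.coe_pow, Subgroup.coe_one]; exact P.2.2)⟩
      left_inv := fun x => rfl
      right_inv := fun P => rfl }

/-- For an INJECTIVE homomorphism `φ : H → G` with range `C`: `#{y ∈ H | y^m = 1} = #{P ∈ G | P ∈ C, P^m = 1}`.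
[cite: Rotman1984, Exercise 6.17] -/
private theorem natCard_torsion_eq_of_injective_of_range_eq {G H : Type*} [Group G] [Group H] (φ : H →* G)
    (hφ : Function.Injective φ) (C : Set G) (hC : Set.range φ = C) (m : ℕ) :
    Nat.card {y : H // y ^ m = 1} = Nat.card {P : G // P ∈ C ∧ P ^ m = 1} := by
  subst hC
  refine Nat.card_congr (Equiv.ofBijective (fun y => ⟨φ y.1, ⟨y.1, rfl⟩, by rw [← map_pow, y.2, map_one]⟩) ⟨?_, ?_⟩)
  · intro y y' h
    exact Subtype.ext (hφ (congrArg (fun P : {P : G // P ∈ Set.range φ ∧ P ^ m = 1} => P.1) h))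
  · rintro ⟨P, ⟨y, rfl⟩, hP⟩
    refine ⟨⟨y, hφ ?_⟩, rfl⟩
    rw [map_pow, hP, map_one]

/-- Additive reading of the torsion count: `#{x ∈ G | n • x = 0}` in `Additive G` is `#{x ∈ G | x^n = 1}`.
[cite: Rotman1984, Exercise 6.17] -/
private theorem natCard_additive_nsmul_eq {G : Type*} [Group G] (n : ℕ) :
    Nat.card {x : Additive G // n • x = 0} = Nat.card {x : G // x ^ n = 1} :=
  Nat.card_congr (Equiv.subtypeEquiv Additive.toMul fun x => by
    rw [← toMul_nsmul]
    exact ⟨fun h => by rw [h]; rfl, fun h => Additive.toMul.injective h⟩)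

/-! ### §3 The head: the type is determined at one geometric point of a connected ℚ-base -/

/-- **LOCAL CONSTANCY OF THE TYPE OF A POLARISATION** ([MumfordFogartyKirwan1994] App. 7A: «`𝒜_{g,d,n} = ∐_δ 𝒜_{g,δ,n}`,
open and closed»).  Let `S` be PRECONNECTED with every positive integer invertible in its residue fields (e.g. a
`ℚ`-scheme), `λ` a polarisation of the abelian scheme `A/S`, `δ` a polarisation type, and suppose that at ONE geometric
point `s̄₀ : Spec Ω₀ → S` the kernel `K(λ̄_s̄₀)` on `Ω₀`-points is the image of an injective homomorphism from
`(∏ᵢ ℤ/δᵢ)²`.  Then `λ` HAS TYPE `δ` (the same holds at every geometric point).  Proof: for each `m ≥ 1` the count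
`#K(λ̄_s̄)[m]` is constant on `S` (★ `HomKernelTorsionCount`: the finite étale `K_m(λ) ⊆ A[m]` and the locally constant
degree), so `K(λ̄_s̄)` and `(∏ᵢ ℤ/δᵢ)²` are finite abelian groups (★ `Polarization.finite_kerPointsAt`) with the same
torsion counts, hence isomorphic (★ Rotman `nonempty_addEquiv_of_forall_natCard_nsmul_eq_zero_eq`).
[cite: MumfordFogartyKirwan1994, App. 7A (pp. 234–235)] [cite: Rotman1984, Exercise 6.17] -/
theorem hasType_of_exists_mulHom_at [PreconnectedSpace S] (hchar : ∀ (s : S) (m : ℕ), 0 < m → (m : S.residueField s) ≠ 0)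
    {g : ℕ} {δ : Fin g → ℕ} (hδ : IsPolarizationType δ) {Ω₀ : Type u} [Field Ω₀] [IsAlgClosed Ω₀]
    (s₀ : Spec (.of Ω₀) ⟶ S)
    (h₀ : ∃ φ : Multiplicative (((i : Fin g) → ZMod (δ i)) × ((i : Fin g) → ZMod (δ i))) →*
        (A.fibre s₀).toAbelianVariety.Points Ω₀, Function.Injective φ ∧ Set.range φ = pol.kerPointsAt s₀) :
    pol.HasType δ := by
  haveI := pol.isMonHom
  haveI : ∀ i, NeZero (δ i) := fun i => ⟨(hδ.1 i).ne'⟩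
  obtain ⟨φ₀, hφ₀, hrange₀⟩ := h₀
  refine ⟨hδ, fun Ω _ _ s => ?_⟩
  -- the kernel `K(λ̄_s̄)` as a subgroup of `A_s̄(Ω)`: the kernel of the homomorphism `λ_s̄` on points
  let Λ : (A.fibre s).toAbelianVariety.Points Ω →* (D.hat.fibre s).toAbelianVariety.Points Ω :=
    { toFun := AlgPoints.map (fibreHom pol.lam s).hom.hom.hom
      map_one' := MonObj.one_comp (fibreHom pol.lam s).hom.hom.hom
      map_mul' := fun P Q => MonObj.mul_comp P Q (fibreHom pol.lam s).hom.hom.hom }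
  have hK : ((Λ.ker : Subgroup _) : Set ((A.fibre s).toAbelianVariety.Points Ω)) = pol.kerPointsAt s := by
    rw [← setOf_algPointsMap_fibreHom_eq_one_eq_kerPointsAt pol s]
    ext P
    exact Λ.mem_ker
  haveI hfinK : Finite Λ.ker := by
    have hf := (pol.finite_kerPointsAt s).to_subtype
    rw [← hK] at hf
    exact hf
  -- equal torsion counts for every `m ≥ 1`
  have hcount : ∀ m : ℕ, 0 < m →
      Nat.card {y : Additive (Multiplicative (((i : Fin g) → ZMod (δ i)) × ((i : Fin g) → ZMod (δ i)))) // m • y = 0} =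
        Nat.card {x : Additive Λ.ker // m • x = 0} := fun m hm0 => by
    rw [natCard_additive_nsmul_eq, natCard_additive_nsmul_eq, natCard_subgroup_torsion_eq Λ.ker _ hK m,
      natCard_torsion_eq_of_injective_of_range_eq φ₀ hφ₀ _ hrange₀ m]
    exact pol.natCard_kerPointsAt_torsion_eq_of_preconnectedSpace (fun x => hchar x m hm0) s₀ s
  -- Rotman: the two finite abelian groups are isomorphic
  obtain ⟨eA⟩ := Literature.GroupTheory.FiniteAbelian.nonempty_addEquiv_of_forall_natCard_nsmul_eq_zero_eq
    (Additive (Multiplicative (((i : Fin g) → ZMod (δ i)) × ((i : Fin g) → ZMod (δ i))))) (Additive Λ.ker) hcount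
  let e : Multiplicative (((i : Fin g) → ZMod (δ i)) × ((i : Fin g) → ZMod (δ i))) ≃* Λ.ker :=
    MulEquiv.toAdditive.symm eA
  refine ⟨Λ.ker.subtype.comp e.toMonoidHom, ?_, ?_⟩
  · exact Λ.ker.subtype_injective.comp e.injective
  · rw [← hK]
    ext P
    constructor
    · rintro ⟨y, rfl⟩
      exact (e y).2
    · intro hP
      exact ⟨e.symm ⟨P, hP⟩, by rw [MonoidHom.coe_comp, Function.comp_apply, MulEquiv.coe_toMonoidHom,
        MulEquiv.apply_symm_apply, Subgroup.coe_subtype]⟩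

/-- **The same over a field of characteristic zero**: for `S` preconnected over `Spec K` with `CharZero K` (e.g. a
connected `ℚ`-scheme — the base of the cell's moduli functor), the type of a polarisation is read off one geometric
point. [cite: MumfordFogartyKirwan1994, App. 7A (pp. 234–235)] -/
theorem hasType_of_exists_mulHom_at_of_charZero [PreconnectedSpace S] {K : Type u} [Field K] [CharZero K]
    (f : S ⟶ Spec (.of K)) {g : ℕ} {δ : Fin g → ℕ} (hδ : IsPolarizationType δ) {Ω₀ : Type u} [Field Ω₀]
    [IsAlgClosed Ω₀] (s₀ : Spec (.of Ω₀) ⟶ S)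
    (h₀ : ∃ φ : Multiplicative (((i : Fin g) → ZMod (δ i)) × ((i : Fin g) → ZMod (δ i))) →*
        (A.fibre s₀).toAbelianVariety.Points Ω₀, Function.Injective φ ∧ Set.range φ = pol.kerPointsAt s₀) :
    pol.HasType δ :=
  pol.hasType_of_exists_mulHom_at (fun s _ hm => natCast_residueField_ne_zero f s hm) hδ s₀ h₀

/-- **`HasType δ` on a connected ℚ-base ⟺ `δ` is a polarisation type and the kernel clause holds at ONE geometric
point** (the converse direction is the definition of ★ `Polarization.HasType`). [cite: MumfordFogartyKirwan1994, App. 7A (pp. 234–235)] -/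
theorem hasType_iff_of_preconnectedSpace [PreconnectedSpace S]
    (hchar : ∀ (s : S) (m : ℕ), 0 < m → (m : S.residueField s) ≠ 0) {g : ℕ} (δ : Fin g → ℕ) {Ω₀ : Type u}
    [Field Ω₀] [IsAlgClosed Ω₀] (s₀ : Spec (.of Ω₀) ⟶ S) :
    pol.HasType δ ↔ IsPolarizationType δ ∧
      ∃ φ : Multiplicative (((i : Fin g) → ZMod (δ i)) × ((i : Fin g) → ZMod (δ i))) →*
        (A.fibre s₀).toAbelianVariety.Points Ω₀, Function.Injective φ ∧ Set.range φ = pol.kerPointsAt s₀ :=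
  ⟨fun h => ⟨HasType.isPolarizationType pol h, HasType.exists_mulHom pol h Ω₀ s₀⟩,
    fun h => pol.hasType_of_exists_mulHom_at hchar h.1 s₀ h.2⟩

/-- **Two polarised abelian schemes over the same connected ℚ-base that share a geometric fibre kernel have the same
type** — transport form used when the type is known at a point of a DIFFERENT but isomorphic fibre: if `pol.HasType δ`
holds and the base has a geometric point, every other type `δ'` read at some point agrees with `δ`
(★ `HasType.eq_of_hasType`). [cite: MumfordFogartyKirwan1994, App. 7A (pp. 234–235)] -/
theorem hasType_unique_of_exists_mulHom_at [PreconnectedSpace S]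
    (hchar : ∀ (s : S) (m : ℕ), 0 < m → (m : S.residueField s) ≠ 0) {g : ℕ} {δ δ' : Fin g → ℕ}
    (hδ : pol.HasType δ) (hδ' : IsPolarizationType δ') {Ω₀ : Type u} [Field Ω₀] [IsAlgClosed Ω₀]
    (s₀ : Spec (.of Ω₀) ⟶ S)
    (h₀ : ∃ φ : Multiplicative (((i : Fin g) → ZMod (δ' i)) × ((i : Fin g) → ZMod (δ' i))) →*
        (A.fibre s₀).toAbelianVariety.Points Ω₀, Function.Injective φ ∧ Set.range φ = pol.kerPointsAt s₀) :
    δ = δ' :=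
  HasType.eq_of_hasType pol hδ (pol.hasType_of_exists_mulHom_at hchar hδ' s₀ h₀) s₀

end Polarization

end AbelianSchemeOver

end Literature.AlgebraicGeometry.AbelianSchemes

end
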